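import Literature.Topology.FourManifolds.MMSWRasmussenFacts
import Literature.Topology.FourManifolds.MMSWRasmussenGeneralPosition
import Summits.SmoothPoincare4.SmoothPoincare4.Theses.DottedCircleRasmussen

/-!
# Helper `helper_handlebodyChart_modelHandles` (M3: handle structure of the model dotted handlebody `D_k`)
# of line `mk_friends` for crux `DcrGap` — the base ball
(item stmt-SmoothPoincare4-16128, route route-SmoothPoincare4-DottedCircleRasmussen)

**Registered piece `helper_handlebodyChart_modelHandles_baseBall` of the model lemma M3.**  M3 starts
with a base ball `B̄(c, 3a/2) ⊆ D_k = MMSW.modelHandlebody k` (the `0`-handle about which the `k`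
handle charts are conical).  Here: for every centre `z₀` of the planar domain with `|z₀| ≤ R/2 - 1/5`
(`R = 40(k+1)`) at distance `≥ 31/20` from the hole centres `c_j = 4(j+1)`, the closed ball of radius
`1/5` about `(z₀, 0) ∈ ℂ² = ℝ⁴` lies in `D_k`, indeed in `{G_k < 1}` — so any `a ≤ 2/15` and any such
`c = (z₀, 0)` (e.g. `z₀` below the row of holes, from which the holes are seen in disjoint directions)
serve as base data.  Proof (`ModelHandles.closedBall_subset_modelHandlebody`): on the ball every hole is
at distance `≥ 27/20` and `|z| ≤ R/2`, so the planar potential is `< 19/20` by the zone estimates of the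
regular-value analysis of `G_k` (`MMSW.potential_lt_of_annulus`, `MMSW.potential_lt_of_forall_le_dist`,
`MMSWRasmussenGeneralPosition.lean`), and `|w|² ≤ 1/25`.

No definitions, no named facts, no `sorry`.

References: R. Kirby, *The Topology of 4-Manifolds*, LNM 1374 (1989), Ch. I §2 [Kirby1989].
-/

-- the prescribed namespace `Summit.<P>.<Sub>.…` duplicates `SmoothPoincare4` (P = Sub)
set_option linter.dupNamespace false
set_option linter.style.longLine false

noncomputable section

open scoped Manifold ContDiff Topology
open Function Set Metric
open Literature.Topology.FourManifolds Literature.Topology.FourManifolds.MMSW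
open Literature.AlgebraicTopology.Homotopy.HopfFibration

namespace Summit.SmoothPoincare4.SmoothPoincare4.Theorems.DcrGap.MkFriends

namespace ModelHandles

/-- `|z(x) - z(y)|` and `|w(x) - w(y)|` are at most `‖x - y‖`. [folklore] -/
theorem normSq_zC_sub_add (x y : EuclideanSpace ℝ (Fin 4)) :
    Complex.normSq (zC x - zC y) + Complex.normSq (wC x - wC y) = ‖x - y‖ ^ 2 := by
  rw [norm_sq_eq]
  rfl

/-- **A base ball inside the model handlebody.**  If `z₀` lies in the disc `|z| ≤ R/2 - 1/5`
(`R = 40(k+1)`) at distance `≥ 31/20` from every hole centre, then the closed ball of radius `1/5`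
about `(z₀, 0)` lies in `D_k`, indeed in `{G_k < 1}`: on it every hole is at distance `≥ 27/20` and
`|z| ≤ R/2`, so the planar potential is `< 19/20` (zones M1–M2 of the regular-value analysis,
`MMSW.potential_lt_of_annulus`, `MMSW.potential_lt_of_forall_le_dist`), while `|w|² ≤ 1/25`. [folklore] -/
theorem closedBall_subset_modelHandlebody (k : ℕ) (z₀ : ℂ)
    (hz₀ : ‖z₀‖ ≤ 40 * ((k : ℝ) + 1) / 2 - 1 / 5)
    (hfar : ∀ j : Fin k, 31 / 20 ≤ ‖z₀ - holeCentre k j‖) :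
    ∀ x ∈ closedBall (ofZW z₀ 0) (1 / 5), x ∈ modelHandlebody k ∧ levelFun k x < 1 := by
  intro x hx
  rw [mem_closedBall, dist_eq_norm] at hx
  have hsq := normSq_zC_sub_add x (ofZW z₀ 0)
  rw [zC_ofZW, wC_ofZW, sub_zero] at hsq
  have hx2 : ‖x - ofZW z₀ 0‖ ^ 2 ≤ (1 / 5) ^ 2 := pow_le_pow_left₀ (norm_nonneg _) hx 2
  have hz : Complex.normSq (zC x - z₀) ≤ 1 / 25 := by nlinarith [Complex.normSq_nonneg (wC x)]
  have hw : Complex.normSq (wC x) ≤ 1 / 25 := by nlinarith [Complex.normSq_nonneg (zC x - z₀)]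
  have hzn : ‖zC x - z₀‖ ≤ 1 / 5 := by
    rw [Complex.normSq_eq_norm_sq] at hz
    nlinarith [norm_nonneg (zC x - z₀)]
  -- distances to the holes and to the origin
  have hdist : ∀ j : Fin k, 27 / 20 ≤ ‖zC x - holeCentre k j‖ := fun j => by
    have := norm_sub_norm_le (z₀ - holeCentre k j) (z₀ - zC x)
    rw [show z₀ - holeCentre k j - (z₀ - zC x) = zC x - holeCentre k j by ring,
      norm_sub_rev z₀ (zC x)] at this
    linarith [hfar j]
  have hnorm : ‖zC x‖ ≤ 40 * ((k : ℝ) + 1) / 2 := by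
    have := norm_add_le z₀ (zC x - z₀)
    rw [add_sub_cancel] at this
    linarith
  have hne : ∀ j : Fin k, zC x ≠ holeCentre k j := fun j h => by
    have := hdist j; rw [h, sub_self, norm_zero] at this; linarith
  -- the planar potential is `< 19/20`
  have hpot : Complex.normSq (zC x) / (40 * ((k : ℝ) + 1)) ^ 2 +
      ∑ j : Fin k, (Complex.normSq (zC x - holeCentre k j))⁻¹ < 19 / 20 := by
    by_cases h8 : 40 * ((k : ℝ) + 1) / 8 ≤ ‖zC x‖
    · exact potential_lt_of_annulus (zC x) h8 hnorm
    · exact potential_lt_of_forall_le_dist (zC x) (le_of_not_ge h8) hdist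
  have hG : levelFun k x < 1 := by
    have h := levelFun_sub_normSq_w (r := k) x
    have hw' : (x 2) ^ 2 + (x 3) ^ 2 = Complex.normSq (wC x) := by
      rw [Complex.normSq_apply]; simp [wC, sq]
    linarith
  refine ⟨⟨fun j => ?_, hG.le⟩, hG⟩
  rw [holeTerm_eq_normSq, Complex.normSq_eq_norm_sq]
  nlinarith [hdist j]

end ModelHandles

/-- **Registered piece `helper_handlebodyChart_modelHandles_baseBall` of the model lemma M3 (a base ball
inside the model handlebody)**: the closed ball of radius `1/5` about `(z₀, 0)` lies in `D_k ∩ {G_k < 1}`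
whenever `|z₀| ≤ R/2 - 1/5` and `z₀` is at distance `≥ 31/20` from every hole centre
(`ModelHandles.closedBall_subset_modelHandlebody`). [folklore] -/
theorem helper_handlebodyChart_modelHandles_baseBall : ∀ (k : ℕ) (z₀ : ℂ), ‖z₀‖ ≤ 40 * ((k : ℝ) + 1) / 2 - 1 / 5 → (∀ j : Fin k, 31 / 20 ≤ ‖z₀ - Literature.Topology.FourManifolds.MMSW.holeCentre k j‖) → ∀ x ∈ Metric.closedBall (Literature.AlgebraicTopology.Homotopy.HopfFibration.ofZW z₀ 0) (1 / 5), x ∈ Literature.Topology.FourManifolds.MMSW.modelHandlebody k ∧ Literature.Topology.FourManifolds.MMSW.levelFun k x < 1 :=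
  fun k z₀ hz₀ hfar => ModelHandles.closedBall_subset_modelHandlebody k z₀ hz₀ hfar

end Summit.SmoothPoincare4.SmoothPoincare4.Theorems.DcrGap.MkFriends

end
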